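import Summits.Ventures.LatticeQCDFlow.Exactness.Phi4MetropolisScanEnvelopeDCT
import Summits.Ventures.LatticeQCDFlow.Exactness.Phi4MetropolisCSDFloor
import HarnessLib

/-!
# CRITICAL SLOWING DOWN OF THE MAGNETISATION under local Metropolis: `τ_int,sweep(M) ≥ 2χ/δ² − ½`

HONEST FRAMING: exact (Metropolis-corrected) sampling algorithms for lattice gauge theory;
figures of merit are autocorrelation/cost numbers at stated couplings and volumes; no
continuum-physics claim.  (SCALAR calibration rung S0-A: not a gauge result.)

Venture `LatticeQCDFlow` (cell pub-lqcd), topic `Exactness`; FANOUT row 2 (`s0-phi4`, LOCAL arm —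
"dynamical exponents z", theorem side; closes the leftover (α): the bound is for the magnetisation
ITSELF, an unbounded square-integrable observable, not a clipped proxy).  NEW WORK of the cell,
composing the abstract sweep-unit locality floor `RevOp.thinned_tauInt_ge_of_carre_le`
(`ReversibleLocalityFloor`) with the admissible class `QuadObs` of quadratic-growth observables for
row 2's random-site-scan Metropolis operator (`Phi4MetropolisScanEnvelope`: integrability,
stability, linearity; `Phi4MetropolisScanEnvelopeDCT`: reversibility and contraction by truncation;
`Phi4MetropolisScan`: `K1 = 1`, bounded moves).  Nothing is cited as a fact.  Printed counterpart of
the per-step inequality, NAMED ONLY: Madras–Slade 1993, Cor. 9.2.3 (p. 304, finite chains).  The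
reading `z_M ≥ γ/ν` for local reversible dynamics is critical-slowing-down folklore, named only.

## What is proved

`Λ = Fin (n+1)` (`V = n+1` sites), lattice φ⁴ Gibbs weight `e^{−S}`, every `λ > 0`, every real
coupling matrix `J`; step law `ρ`: even probability density vanishing outside `[−δ, δ]`, `δ ≥ 0`;
`M = Σ_x φ_x`, `g = M − ⟨M⟩`, `K = metroScan J λ ρ` (pick a site uniformly, Metropolis hit),
`ρ_g(k) = ∫ g (Kᵏ g) e^{−S} / ∫ g² e^{−S}`, one sweep = `V` site updates,
`χ = Var(M)/V = ⟨(M − ⟨M⟩)²⟩/V` the susceptibility.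

* `magnetisation_linear_growth` — `|M − c| ≤ (1 + |c|)(1 + Σ|φ_w|)` (so `g, g² ∈ QuadObs`);
* `magnetisation_move_sq_le` — a window proposal moves `g` by at most `δ`;
* **`metropolisScan_tauInt_sweep_ge_magnetisation`** — if the sweep-thinned autocorrelation series of
  `g` is summable and `ρ_g(V) < 1`, then
  `τ_int,sweep(M) = ½ + Σ_{k≥1} ρ_g(Vk) ≥ 2 Var(M)/(V δ²) − ½ = 2χ/δ² − ½`.

Reading (no numerics implied): at the engine's `δ = 0.5` the random-scan local arm needs at least
`8χ − ½` sweeps per independent magnetisation sample; wherever `χ ∼ L^{γ/ν}` this is `z_int,M ≥ γ/ν`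
(`= 7/4` in the 2D Ising class), and in a two-phase regime (`Var(M) ≈ V² m²`) the floor is
`≈ 2 V m²/δ²` sweeps — tunnelling is frozen linearly in the volume.  NOT CLAIMED: the ordered sweep
(not reversible); `ρ_g(V) < 1` / summability for any run (hypotheses); any value of `χ`; HMC / flow
arms; step laws with unbounded support.
-/

namespace Summit.Ventures.LatticeQCDFlow.Exactness

open Real MeasureTheory Filter Finset
open Summit.Ventures.LatticeQCDFlow.Scoring

section MagnetisationCSD

variable {n : ℕ}

/-- The centred magnetisation has linear growth: `|Σ_x φ_x − c| ≤ (1 + |c|)(1 + Σ_w |φ_w|)`. -/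
theorem magnetisation_linear_growth (c : ℝ) (φ : Fin (n + 1) → ℝ) :
    |(∑ y, φ y) - c| ≤ (1 + |c|) * (1 + ∑ w, |φ w|) := by
  have h0 : |∑ y, φ y| ≤ ∑ w, |φ w| := Finset.abs_sum_le_sum_abs _ _
  have h1 : |(∑ y, φ y) - c| ≤ |∑ y, φ y| + |c| := abs_sub _ _
  have hS : 0 ≤ ∑ w, |φ w| := Finset.sum_nonneg fun w _ => abs_nonneg (φ w)
  nlinarith [abs_nonneg c]

/-- A window proposal moves the centred magnetisation by at most `δ`:
`ρ(t' − φ_x) ≠ 0 ⇒ ((M(φ|φ_x:=t') − c) − (M φ − c))² ≤ δ²`. -/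
theorem magnetisation_move_sq_le {ρ : ℝ → ℝ} {δ : ℝ} (hρδ : ∀ u, δ < |u| → ρ u = 0) (c : ℝ)
    (φ : Fin (n + 1) → ℝ) (x : Fin (n + 1)) (t' : ℝ) (hne : ρ (t' - φ x) ≠ 0) :
    (((∑ y, Function.update φ x t' y) - c) - ((∑ y, φ y) - c)) ^ 2 ≤ δ ^ 2 := by
  have hle : |t' - φ x| ≤ δ := by
    by_contra h
    exact hne (hρδ _ (lt_of_not_ge h))
  have e : ((∑ y, Function.update φ x t' y) - c) - ((∑ y, φ y) - c) = t' - φ x := by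
    rw [← sum_update_sub_sum φ x t']
    ring
  rw [e, ← sq_abs]
  exact pow_le_pow_left₀ (abs_nonneg _) hle 2

/-- **CRITICAL SLOWING DOWN OF THE MAGNETISATION UNDER RANDOM-SCAN LOCAL METROPOLIS.**
Lattice φ⁴ on `ℝ^Λ`, `Λ = Fin (n+1)`, every `λ > 0`, every real `J`; `ρ` an even probability density
vanishing outside `[−δ, δ]` (`δ ≥ 0`); `M = Σ_x φ_x`, `g = M − ⟨M⟩`, `K` the random-site-scan
Metropolis operator, one sweep = `n+1` site updates.  If the sweep-thinned autocorrelation series of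
`g` is summable and `ρ_g(n+1) < 1`, then
`τ_int,sweep(M) = ½ + Σ_{k≥1} ρ_g((n+1)k) ≥ 2 ⟨(M − ⟨M⟩)²⟩ / ((n+1) δ²) − ½ = 2χ/δ² − ½`. -/
theorem metropolisScan_tauInt_sweep_ge_magnetisation {lam : ℝ} (hlam : 0 < lam)
    (J : Fin (n + 1) → Fin (n + 1) → ℝ) {ρ : ℝ → ℝ} (hρ0 : ∀ u, 0 ≤ ρ u) (hρm : Measurable ρ)
    (hρi : Integrable ρ) (hρ1 : ∫ u, ρ u = 1) (hρs : ∀ u, ρ (-u) = ρ u) {δ : ℝ} (hδ : 0 ≤ δ)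
    (hρδ : ∀ u, δ < |u| → ρ u = 0)
    (hs : Summable fun k => (∫ φ, ((∑ y, φ y) - gibbsExpect J lam (fun ψ => ∑ y, ψ y))
        * ((metroScan J lam ρ)^[(n + 1) * (k + 1)]
            (fun ψ => (∑ y, ψ y) - gibbsExpect J lam (fun ψ => ∑ y, ψ y))) φ * gibbsWeight J lam φ)
        / ∫ φ, ((∑ y, φ y) - gibbsExpect J lam (fun ψ => ∑ y, ψ y)) ^ 2 * gibbsWeight J lam φ)
    (hρV : (∫ φ, ((∑ y, φ y) - gibbsExpect J lam (fun ψ => ∑ y, ψ y))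
        * ((metroScan J lam ρ)^[n + 1]
            (fun ψ => (∑ y, ψ y) - gibbsExpect J lam (fun ψ => ∑ y, ψ y))) φ * gibbsWeight J lam φ)
        / (∫ φ, ((∑ y, φ y) - gibbsExpect J lam (fun ψ => ∑ y, ψ y)) ^ 2 * gibbsWeight J lam φ)
        < 1) :
    2 * gibbsExpect J lam (fun φ => ((∑ y, φ y) - gibbsExpect J lam (fun ψ => ∑ y, ψ y)) ^ 2)
        / ((n + 1) * δ ^ 2) - 1 / 2
      ≤ tauInt (fun k => (∫ φ, ((∑ y, φ y) - gibbsExpect J lam (fun ψ => ∑ y, ψ y))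
        * ((metroScan J lam ρ)^[(n + 1) * k]
            (fun ψ => (∑ y, ψ y) - gibbsExpect J lam (fun ψ => ∑ y, ψ y))) φ * gibbsWeight J lam φ)
        / ∫ φ, ((∑ y, φ y) - gibbsExpect J lam (fun ψ => ∑ y, ψ y)) ^ 2 * gibbsWeight J lam φ) := by
  have hco := latticePhi4Action_coercive hlam J
  set c := gibbsExpect J lam (fun ψ : Fin (n + 1) → ℝ => ∑ y, ψ y) with hc
  have hgm : Measurable (fun ψ : Fin (n + 1) → ℝ => (∑ y, ψ y) - c) :=
    (Finset.measurable_sum _ fun y _ => measurable_pi_apply y).sub measurable_const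
  have hglin : ∀ φ : Fin (n + 1) → ℝ, |(∑ y, φ y) - c| ≤ (1 + |c|) * (1 + ∑ w, |φ w|) :=
    fun φ => magnetisation_linear_growth c φ
  have hg : QuadObs (fun ψ : Fin (n + 1) → ℝ => (∑ y, ψ y) - c) := quadObs_of_linear_growth hgm hglin
  have hg2 : QuadObs (fun ψ : Fin (n + 1) → ℝ => ((∑ y, ψ y) - c) ^ 2) :=
    quadObs_sq_of_linear_growth hgm hglin
  have hΓ : ∀ φ, metroScan J lam ρ (fun ψ => (((∑ y, ψ y) - c) - ((∑ y, φ y) - c)) ^ 2) φ ≤ δ ^ 2 :=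
    fun φ => metroScan_sq_dev_le J lam hρ0 hρi hρ1 φ fun x t' hne =>
      magnetisation_move_sq_le hρδ c φ x t' hne
  have hfloor := RevOp.thinned_tauInt_ge_of_carre_le (μ := volume) (A := QuadObs)
    (K := metroScan J lam ρ) (w := gibbsWeight J lam)
    (fun φ => (gibbsWeight_pos J lam φ).le) (quadObs_const 1)
    (fun f h hf hh => quadObs_integrable_mul_mul_gibbsWeight one_pos hco hf hh)
    (fun f h c hf hh => quadObs_add_mul hf hh c)
    (fun f hf => quadObs_metroScan J lam hρ0 hρm hρi hρ1 hδ hρδ hf)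
    (fun f h c hf hh x => metroScan_add_mul_quad J lam hρ0 hρm hρi hδ hρδ hf hh c x)
    (fun f h hf hh => metroScan_reversible_quad one_pos hco hρ0 hρm hρi hρ1 hρs hδ hρδ hf hh)
    (fun f hf => metroScan_contraction_quad one_pos hco hρ0 hρm hρi hρ1 hρs hδ hρδ hf)
    (fun φ => metroScan_one J lam hρ1 φ) hg hg2 hΓ (show 0 < n + 1 by omega) hs hρV
  have e : ∀ P Z : ℝ, 2 * (P / Z) / (((n : ℝ) + 1) * δ ^ 2) - 1 / 2
      = 2 * P / (((n + 1 : ℕ) : ℝ) * δ ^ 2 * Z) - 1 / 2 := by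
    intro P Z
    push_cast
    rw [← mul_div_assoc, div_div, mul_comm Z]
  exact (e _ _).le.trans hfloor

end MagnetisationCSD

end Summit.Ventures.LatticeQCDFlow.Exactness
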